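import Literature.NumberTheory.Sieve.FGKMT2018LocalPairSumVanishing
import HarnessLib

/-!
# Multidimensional Selberg sieve on a general box: change of variables and the diagonal support

Source: J. Maynard, *Dense clusters of primes in subsets*, Compositio Math. 152 (2016) =
arXiv:1405.2593 [Maynard2016DenseClusters]: §7 (8.6) p. 14 (the variables `y_r`), proof of
Proposition 9.1 p. 19, displays (9.2) and (9.5) (change of variables and the evaluation of the local
pair sum «`= 0` if `p ∣ r, p ∤ s`»), and proof of Proposition 9.4 pp. 25–26 («exactly the same
argument but for `(k+1)`-dimensional vectors»).

The tree's `FGKMT2018QuadFormSwap` / `FGKMT2018LocalPairSumVanishing` prove (9.2)/(9.5) for the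
specific support set `𝒟_k(𝓛) = dkBox L B R` of FGKMT's Theorem 6 (index type `Fin k`, one level
`R`, the modulus `W = ∏_{p ≤ 2k²} p` tied to `k`). The proof of Proposition 9.4 runs the same
algebra for `(k+1)`-dimensional vectors `(d₁,…,d_k,d₀)` with a DIFFERENT level in the last
coordinate (`R₀ = N^ξ`) and different coprimality constraints per coordinate; this file records the
algebra once for a GENERAL BOX

  `gBox N W = {d : ι → ℕ : 1 ≤ d_j ≤ N_j, μ²(∏_j d_j) = 1, (d_j, W_j) = 1 ∀ j}`

over any finite index type `ι` (levels `N : ι → ℕ`, forbidden moduli `W : ι → ℕ`); `dkBox L B R` is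
the case `ι = Fin k`, `N_j = ⌊R⌋`, `W_j = W_j(𝓛)` (`FGKMT2018YSquareSumBridge.mem_dkBox_iff_coprime_idxMod`).
PROVED here (no named facts), for ANY weights:

* `gBox` is divisor-closed (`mem_gBox_of_dvd`), `{d ∈ gBox : d ∣ r} = ∏_j divisors(r_j)`;
* `lamOfY` — `λ_d = μ(d) d ∑_{r ∈ gBox, d ∣ r} Y_r` ((8.6) with `Y_r = y_r/φ_ω(r)`), `pairTerm`,
  `pairT` — `T(r,s) = ∑'_{d∣r, e∣s} μ(d)μ(e)de/∏_j[d_j,e_j]`;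
* **`quadForm_eq_sum`** — display (9.2): `∑'_{d,e} λ_dλ_e/∏[d_j,e_j] = ∑_{r,s} Y_r Y_s T(r,s)`;
* **`sum_filter_dvd_pairTerm_eq_zero`**, **`pairT_eq_zero_of_prod_ne`** — (9.5)ff.: `T(r,s) = 0`
  unless `∏ r_j = ∏ s_j` (sign-reversing involution `d_j ↦ d_j p^{±1}`).

## References
* J. Maynard, *Dense clusters of primes in subsets*, Compositio Math. 152 (2016), (8.6), (9.2),
  (9.5), proof of Prop. 9.4 pp. 25–26 [Maynard2016DenseClusters].
* K. Ford, B. Green, S. Konyagin, J. Maynard, T. Tao, *Long gaps between primes*, JAMS 31 (2018),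
  (7.5)–(7.7) p. 21 [FordGreenKonyaginMaynardTao2018].
-/

noncomputable section

open Finset
open scoped ArithmeticFunction.Moebius

namespace Literature.NumberTheory.Sieve.SelbergBox

variable {ι : Type*} [Fintype ι] [DecidableEq ι]

/-! ### The general box -/

/-- The general support box `{d : ι → ℕ : 1 ≤ d_j ≤ N_j, μ²(∏ d_j) = 1, (d_j, W_j) = 1}`
(`𝒟_k(𝓛) = dkBox` of FGKMT (7.5) is the case `N_j = ⌊R⌋`, `W_j = W_j(𝓛)`; the box of the proof of
Prop. 9.4 has one more coordinate of level `R₀`).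
[cite: Maynard2016DenseClusters, §7 p. 13 (𝒟_k), proof of Prop. 9.4 p. 25 ((k+1)-dimensional vectors); FordGreenKonyaginMaynardTao2018, (7.5) p. 21] -/
def gBox (N W : ι → ℕ) : Finset (ι → ℕ) :=
  (Fintype.piFinset fun j => Finset.Icc 1 (N j)).filter fun d =>
    Squarefree (∏ j, d j) ∧ ∀ j, (d j).Coprime (W j)

section Basics

variable {N W : ι → ℕ}

/-- Membership in the box. [cite: Maynard2016DenseClusters, §7 p. 13] -/
theorem mem_gBox {d : ι → ℕ} :
    d ∈ gBox N W ↔ (∀ j, 1 ≤ d j ∧ d j ≤ N j) ∧ Squarefree (∏ j, d j) ∧ ∀ j, (d j).Coprime (W j) := by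
  unfold gBox
  rw [Finset.mem_filter, Fintype.mem_piFinset]
  simp only [Finset.mem_Icc]

/-- `d ∈ gBox ⇒ 1 ≤ d_j`. [cite: Maynard2016DenseClusters, §7 p. 13] -/
theorem one_le_of_mem_gBox {d : ι → ℕ} (hd : d ∈ gBox N W) (j : ι) : 1 ≤ d j :=
  ((mem_gBox.1 hd).1 j).1

/-- `d ∈ gBox ⇒ d_j ≤ N_j`. [cite: Maynard2016DenseClusters, §7 p. 13] -/
theorem le_of_mem_gBox {d : ι → ℕ} (hd : d ∈ gBox N W) (j : ι) : d j ≤ N j :=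
  ((mem_gBox.1 hd).1 j).2

/-- `d ∈ gBox ⇒ μ²(∏ d_j) = 1`. [cite: Maynard2016DenseClusters, §7 p. 13] -/
theorem squarefree_of_mem_gBox {d : ι → ℕ} (hd : d ∈ gBox N W) : Squarefree (∏ j, d j) :=
  (mem_gBox.1 hd).2.1

/-- `d ∈ gBox ⇒ (d_j, W_j) = 1`. [cite: Maynard2016DenseClusters, §7 p. 13] -/
theorem coprime_of_mem_gBox {d : ι → ℕ} (hd : d ∈ gBox N W) (j : ι) : (d j).Coprime (W j) :=
  (mem_gBox.1 hd).2.2 j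

/-- `d ∈ gBox ⇒ d_j` squarefree. [cite: Maynard2016DenseClusters, §7 p. 13] -/
theorem squarefree_apply_of_mem_gBox {d : ι → ℕ} (hd : d ∈ gBox N W) (j : ι) : Squarefree (d j) :=
  Squarefree.squarefree_of_dvd (Finset.dvd_prod_of_mem _ (Finset.mem_univ j))
    (squarefree_of_mem_gBox hd)

/-- `μ²(∏ d_j) = 1 ⇒ (d_i, d_j) = 1` for `i ≠ j`. [cite: Maynard2016DenseClusters, §7 p. 13] -/
theorem coprime_apply_of_squarefree_prod {d : ι → ℕ} (h : Squarefree (∏ j, d j)) {i j : ι}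
    (hij : i ≠ j) : (d i).Coprime (d j) := by
  classical
  refine Nat.coprime_of_dvd fun p hp hpi hpj => ?_
  have hdvd : d i * d j ∣ ∏ l, d l := by
    rw [← Finset.mul_prod_erase Finset.univ d (Finset.mem_univ i)]
    exact mul_dvd_mul_left _
      (Finset.dvd_prod_of_mem _ (Finset.mem_erase.2 ⟨hij.symm, Finset.mem_univ j⟩))
  have hpp : p * p ∣ ∏ l, d l := (mul_dvd_mul hpi hpj).trans hdvd
  exact hp.not_isUnit (h p hpp)

/-- `d ∈ gBox ⇒ (d_i, d_j) = 1` for `i ≠ j`. [cite: Maynard2016DenseClusters, §7 p. 13] -/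
theorem coprime_apply_of_mem_gBox {d : ι → ℕ} (hd : d ∈ gBox N W) {i j : ι} (hij : i ≠ j) :
    (d i).Coprime (d j) :=
  coprime_apply_of_squarefree_prod (squarefree_of_mem_gBox hd) hij

/-- **The box is divisor-closed**: `r ∈ gBox`, `d_j ∣ r_j ∀ j ⇒ d ∈ gBox`.
[cite: Maynard2016DenseClusters, §7 p. 13–14 ((8.6): λ_d supported on divisor vectors)] -/
theorem mem_gBox_of_dvd {r d : ι → ℕ} (hr : r ∈ gBox N W) (hd : ∀ j, d j ∣ r j) :
    d ∈ gBox N W := by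
  obtain ⟨hrbox, hrsq, hrcop⟩ := mem_gBox.1 hr
  have hd0 : ∀ j, d j ≠ 0 := fun j h0 => by
    have := hd j
    rw [h0, zero_dvd_iff] at this
    exact absurd this (Nat.one_le_iff_ne_zero.1 (hrbox j).1)
  have hprod : (∏ j, d j) ∣ ∏ j, r j := Finset.prod_dvd_prod_of_dvd _ _ fun j _ => hd j
  refine mem_gBox.2 ⟨fun j => ⟨Nat.one_le_iff_ne_zero.2 (hd0 j), ?_⟩, ?_, fun j => ?_⟩
  · exact (Nat.le_of_dvd (hrbox j).1 (hd j)).trans (hrbox j).2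
  · exact Squarefree.squarefree_of_dvd hprod hrsq
  · exact Nat.Coprime.coprime_dvd_left (hd j) (hrcop j)

/-- For `r ∈ gBox`: `{d ∈ gBox : d_j ∣ r_j ∀ j} = ∏_j divisors(r_j)`.
[cite: Maynard2016DenseClusters, (8.6) p. 14, (9.2) p. 19] -/
theorem filter_dvd_eq_piFinset_divisors {r : ι → ℕ} (hr : r ∈ gBox N W) :
    (gBox N W).filter (fun d => ∀ j, d j ∣ r j) = Fintype.piFinset fun j => (r j).divisors := by
  ext d
  simp only [Finset.mem_filter, Fintype.mem_piFinset, Nat.mem_divisors]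
  constructor
  · rintro ⟨-, hd⟩ j
    exact ⟨hd j, Nat.one_le_iff_ne_zero.1 (one_le_of_mem_gBox hr j)⟩
  · intro h
    exact ⟨mem_gBox_of_dvd hr fun j => (h j).1, fun j => (h j).1⟩

end Basics

/-! ### Weights, the pair term, and the change of variables (9.2) -/

/-- The summand of the local pair sum: `[cross-coprime] μ(d)μ(e) d e/∏_j [d_j,e_j]`
(`d = ∏ d_j`; cross-coprime: `(d_i e_i, d_l e_l) = 1` for `i ≠ l`).
[cite: Maynard2016DenseClusters, (9.2) p. 19] -/
def pairTerm (d e : ι → ℕ) : ℝ :=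
  if ∀ i l, i ≠ l → (d i * e i).Coprime (d l * e l) then
    ((μ (∏ j, d j) : ℤ) : ℝ) * ((μ (∏ j, e j) : ℤ) : ℝ) * ((∏ j, (d j : ℝ)) * ∏ j, (e j : ℝ)) /
      ∏ j, ((Nat.lcm (d j) (e j) : ℕ) : ℝ)
  else 0

/-- The local pair sum `T(r,s) = ∑_{d ∣ r} ∑_{e ∣ s} pairTerm d e` (divisor vectors inside the box).
[cite: Maynard2016DenseClusters, (9.2) p. 19] -/
def pairT (N W : ι → ℕ) (r s : ι → ℕ) : ℝ :=
  ∑ d ∈ (gBox N W).filter (fun d => ∀ j, d j ∣ r j),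
    ∑ e ∈ (gBox N W).filter (fun e => ∀ j, e j ∣ s j), pairTerm d e

/-- The sieve weights in terms of the diagonal variables: `λ_d = μ(d) d ∑_{r ∈ box, d ∣ r} Y_r`
((8.6) with `Y_r = y_r/φ_ω(r)`). [cite: Maynard2016DenseClusters, (8.6) p. 14] -/
def lamOfY (N W : ι → ℕ) (Y : (ι → ℕ) → ℝ) (d : ι → ℕ) : ℝ :=
  ((μ (∏ j, d j) : ℤ) : ℝ) * (∏ j, (d j : ℝ)) *
    ∑ r ∈ (gBox N W).filter (fun r => ∀ j, d j ∣ r j), Y r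

/-- **[Maynard2016DenseClusters, display (9.2) p. 19] on a general box** (any `Y`):
`∑_{d,e ∈ box} [cross-coprime] λ_d λ_e/∏[d_j,e_j] = ∑_{r,s ∈ box} Y_r Y_s T(r,s)` for `λ = lamOfY Y`.
[cite: Maynard2016DenseClusters, (9.2) p. 19, (8.6) p. 14, proof of Prop. 9.4 p. 25] -/
theorem quadForm_eq_sum (N W : ι → ℕ) (Y : (ι → ℕ) → ℝ) :
    ∑ d ∈ gBox N W, ∑ e ∈ gBox N W,
        (if ∀ i l, i ≠ l → (d i * e i).Coprime (d l * e l) then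
          lamOfY N W Y d * lamOfY N W Y e / ∏ j, ((Nat.lcm (d j) (e j) : ℕ) : ℝ) else 0) =
      ∑ r ∈ gBox N W, ∑ s ∈ gBox N W, Y r * Y s * pairT N W r s := by
  set box := gBox N W with hbox
  set g : (ι → ℕ) → (ι → ℕ) → (ι → ℕ) → (ι → ℕ) → ℝ := fun d e r s =>
    pairTerm d e * ((if ∀ j, d j ∣ r j then Y r else 0) * (if ∀ j, e j ∣ s j then Y s else 0))
    with hg
  have hL : ∀ d ∈ box, ∀ e ∈ box,
      (if ∀ i l, i ≠ l → (d i * e i).Coprime (d l * e l) then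
          lamOfY N W Y d * lamOfY N W Y e / ∏ j, ((Nat.lcm (d j) (e j) : ℕ) : ℝ) else 0) =
        ∑ r ∈ box, ∑ s ∈ box, g d e r s := by
    intro d _ e _
    have hSd : ∑ r ∈ box.filter (fun r => ∀ j, d j ∣ r j), Y r =
        ∑ r ∈ box, (if ∀ j, d j ∣ r j then Y r else 0) := Finset.sum_filter _ _
    have hSe : ∑ s ∈ box.filter (fun s => ∀ j, e j ∣ s j), Y s =
        ∑ s ∈ box, (if ∀ j, e j ∣ s j then Y s else 0) := Finset.sum_filter _ _
    by_cases hP : ∀ i l, i ≠ l → (d i * e i).Coprime (d l * e l)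
    · rw [if_pos hP]
      unfold lamOfY
      rw [hSd, hSe]
      simp only [hg, pairTerm, if_pos hP]
      rw [FGKMT2018.sum_sum_const_mul_mul]
      ring
    · rw [if_neg hP]
      symm
      refine Finset.sum_eq_zero fun r _ => Finset.sum_eq_zero fun s _ => ?_
      simp only [hg, pairTerm, if_neg hP, zero_mul]
  have hR : ∀ r ∈ box, ∀ s ∈ box,
      Y r * Y s * pairT N W r s = ∑ d ∈ box, ∑ e ∈ box, g d e r s := by
    intro r _ s _
    unfold pairT
    rw [Finset.sum_filter, Finset.mul_sum]
    refine Finset.sum_congr rfl fun d _ => ?_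
    split_ifs with hdr
    · rw [Finset.sum_filter, Finset.mul_sum]
      refine Finset.sum_congr rfl fun e _ => ?_
      split_ifs with hes
      · simp only [hg, if_pos hdr, if_pos hes]; ring
      · simp only [hg, if_neg hes, mul_zero]
    · rw [mul_zero]; symm
      refine Finset.sum_eq_zero fun e _ => ?_
      simp only [hg, if_neg hdr, zero_mul, mul_zero]
  rw [Finset.sum_congr rfl fun d hd => Finset.sum_congr rfl fun e he => hL d hd e he,
    Finset.sum_congr rfl fun r hr => Finset.sum_congr rfl fun s hs => hR r hr s hs]
  calc ∑ d ∈ box, ∑ e ∈ box, ∑ r ∈ box, ∑ s ∈ box, g d e r s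
      = ∑ d ∈ box, ∑ r ∈ box, ∑ e ∈ box, ∑ s ∈ box, g d e r s :=
        Finset.sum_congr rfl fun d _ => Finset.sum_comm
    _ = ∑ r ∈ box, ∑ d ∈ box, ∑ e ∈ box, ∑ s ∈ box, g d e r s := Finset.sum_comm
    _ = ∑ r ∈ box, ∑ d ∈ box, ∑ s ∈ box, ∑ e ∈ box, g d e r s :=
        Finset.sum_congr rfl fun r _ => Finset.sum_congr rfl fun d _ => Finset.sum_comm
    _ = ∑ r ∈ box, ∑ s ∈ box, ∑ d ∈ box, ∑ e ∈ box, g d e r s :=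
        Finset.sum_congr rfl fun r _ => Finset.sum_comm

/-! ### Möbius inversion on the box: every weight is a `lamOfY` -/

/-- The diagonal variables of given weights `Λ`: `Y_r = μ(r) ∑_{f ∈ box, r ∣ f} Λ_f/f`
((8.6) inverted). [cite: Maynard2016DenseClusters, §7 p. 14 (y_r in terms of λ_d)] -/
def dualY (N W : ι → ℕ) (Λ : (ι → ℕ) → ℝ) (r : ι → ℕ) : ℝ :=
  ((μ (∏ j, r j) : ℤ) : ℝ) * ∑ f ∈ (gBox N W).filter (fun f => ∀ j, r j ∣ f j), Λ f / ∏ j, (f j : ℝ)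

/-- Möbius over divisor VECTORS of a vector with squarefree product:
`∑_{t : t_j ∣ m_j} μ(∏ t_j) = [m = 1]`. [cite: Maynard2016DenseClusters, §7 p. 14 (Möbius inversion)] -/
theorem sum_piFinset_divisors_moebius {m : ι → ℕ} (hm : Squarefree (∏ j, m j)) :
    ∑ t ∈ Fintype.piFinset (fun j => (m j).divisors), ((μ (∏ j, t j) : ℤ) : ℝ) =
      if ∀ j, m j = 1 then 1 else 0 := by
  have hmul : ∀ t ∈ Fintype.piFinset (fun j => (m j).divisors),
      ((μ (∏ j, t j) : ℤ) : ℝ) = ∏ j, ((μ (t j) : ℤ) : ℝ) := by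
    intro t ht
    have ht' : ∀ j, t j ∣ m j := fun j => (Nat.mem_divisors.1 (Fintype.mem_piFinset.1 ht j)).1
    have hsq : Squarefree (∏ j, t j) :=
      hm.squarefree_of_dvd (Finset.prod_dvd_prod_of_dvd _ _ fun j _ => ht' j)
    have hpw : ((Finset.univ : Finset ι) : Set ι).Pairwise (Function.onFun Nat.Coprime t) :=
      fun i _ l _ hil => coprime_apply_of_squarefree_prod hsq hil
    rw [ArithmeticFunction.isMultiplicative_moebius.map_prod t Finset.univ hpw]
    push_cast
    rfl
  rw [Finset.sum_congr rfl hmul,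
    ← Finset.prod_univ_sum (fun j => (m j).divisors) (fun _ a => ((μ a : ℤ) : ℝ))]
  have hj : ∀ j, ∑ x ∈ (m j).divisors, ((μ x : ℤ) : ℝ) = if m j = 1 then 1 else 0 := by
    intro j
    have h0 : ∑ t ∈ (m j).divisors, (μ t : ℤ) = if m j = 1 then 1 else 0 := by
      have h := congrArg (fun f : ArithmeticFunction ℤ => f (m j))
        ArithmeticFunction.moebius_mul_coe_zeta
      simp only [ArithmeticFunction.coe_mul_zeta_apply, ArithmeticFunction.one_apply] at h
      exact h
    have h := congrArg (fun z : ℤ => (z : ℝ)) h0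
    push_cast at h
    exact h
  simp_rw [hj]
  rw [Fintype.prod_boole]

/-- **Möbius inversion on the box**: for `d ∈ box`, `lamOfY (dualY Λ) d = Λ_d`, i.e. every weight
vector on the box is of the form (8.6) with `Y = dualY Λ`.
[cite: Maynard2016DenseClusters, §7 p. 14 ((8.6) and its inversion); proof of Prop. 9.4 p. 25] -/
theorem lamOfY_dualY (N W : ι → ℕ) (Λ : (ι → ℕ) → ℝ) {d : ι → ℕ} (hd : d ∈ gBox N W) :
    lamOfY N W (dualY N W Λ) d = Λ d := by
  set box := gBox N W with hbox
  set D : ℕ := ∏ j, d j with hD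
  have hd1 : ∀ j, 1 ≤ d j := one_le_of_mem_gBox hd
  have hDsq : Squarefree D := squarefree_of_mem_gBox hd
  have hD0 : (D : ℝ) ≠ 0 := by exact_mod_cast hDsq.ne_zero
  -- Step 1: swap the two sums.
  have hswap : ∑ r ∈ box.filter (fun r => ∀ j, d j ∣ r j), dualY N W Λ r =
      ∑ f ∈ box.filter (fun f => ∀ j, d j ∣ f j), Λ f / (∏ j, (f j : ℝ)) *
        ∑ r ∈ (box.filter (fun r => ∀ j, d j ∣ r j)).filter (fun r => ∀ j, r j ∣ f j),
          ((μ (∏ j, r j) : ℤ) : ℝ) := by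
    unfold dualY
    have h1 : ∑ r ∈ box.filter (fun r => ∀ j, d j ∣ r j),
        ((μ (∏ j, r j) : ℤ) : ℝ) * ∑ f ∈ box.filter (fun f => ∀ j, r j ∣ f j), Λ f / ∏ j, (f j : ℝ) =
        ∑ r ∈ box.filter (fun r => ∀ j, d j ∣ r j), ∑ f ∈ box,
          (if ∀ j, r j ∣ f j then ((μ (∏ j, r j) : ℤ) : ℝ) * (Λ f / ∏ j, (f j : ℝ)) else 0) := by
      refine Finset.sum_congr rfl fun r _ => ?_
      rw [Finset.mul_sum, Finset.sum_filter]
    rw [h1, Finset.sum_comm]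
    -- now ∑_f ∑_{r : d ∣ r} [r ∣ f] … ; split f by d ∣ f
    rw [← Finset.sum_filter_add_sum_filter_not box (fun f => ∀ j, d j ∣ f j)]
    have hzero : ∑ f ∈ box.filter (fun f => ¬ ∀ j, d j ∣ f j),
        ∑ r ∈ box.filter (fun r => ∀ j, d j ∣ r j),
          (if ∀ j, r j ∣ f j then ((μ (∏ j, r j) : ℤ) : ℝ) * (Λ f / ∏ j, (f j : ℝ)) else 0) = 0 := by
      refine Finset.sum_eq_zero fun f hf => Finset.sum_eq_zero fun r hr => ?_
      have hf' := (Finset.mem_filter.1 hf).2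
      have hr' := (Finset.mem_filter.1 hr).2
      rw [if_neg]
      intro hrf
      exact hf' fun j => (hr' j).trans (hrf j)
    rw [hzero, add_zero]
    refine Finset.sum_congr rfl fun f _ => ?_
    rw [Finset.mul_sum, Finset.sum_filter (p := fun r : ι → ℕ => ∀ j, r j ∣ f j)]
    refine Finset.sum_congr rfl fun r _ => ?_
    split_ifs <;> ring
  -- Step 2: the inner Möbius sum is `μ(D) [f = d]`.
  have hinner : ∀ f ∈ box.filter (fun f => ∀ j, d j ∣ f j),
      ∑ r ∈ (box.filter (fun r => ∀ j, d j ∣ r j)).filter (fun r => ∀ j, r j ∣ f j),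
          ((μ (∏ j, r j) : ℤ) : ℝ) = ((μ D : ℤ) : ℝ) * (if f = d then 1 else 0) := by
    intro f hf
    obtain ⟨hfbox, hdf⟩ := Finset.mem_filter.1 hf
    have hfsq : Squarefree (∏ j, f j) := squarefree_of_mem_gBox hfbox
    have hf1 : ∀ j, 1 ≤ f j := one_le_of_mem_gBox hfbox
    set m : ι → ℕ := fun j => f j / d j with hm
    have hfm : ∀ j, f j = d j * m j := fun j => by
      rw [hm]; exact (Nat.mul_div_cancel' (hdf j)).symm
    have hmsq : Squarefree (∏ j, m j) :=
      hfsq.squarefree_of_dvd (Finset.prod_dvd_prod_of_dvd _ _ fun j _ => ⟨d j, by rw [hfm j]; ring⟩)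
    -- reindex r = d * t
    have hre : ∑ r ∈ (box.filter (fun r => ∀ j, d j ∣ r j)).filter (fun r => ∀ j, r j ∣ f j),
          ((μ (∏ j, r j) : ℤ) : ℝ) =
        ∑ t ∈ Fintype.piFinset (fun j => (m j).divisors), ((μ (∏ j, d j * t j) : ℤ) : ℝ) := by
      refine Finset.sum_nbij' (fun r j => r j / d j) (fun t j => d j * t j) ?_ ?_ ?_ ?_ ?_
      · intro r hr
        obtain ⟨hr1, hrf⟩ := Finset.mem_filter.1 hr
        obtain ⟨-, hdr⟩ := Finset.mem_filter.1 hr1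
        refine Fintype.mem_piFinset.2 fun j => Nat.mem_divisors.2 ⟨?_, ?_⟩
        · obtain ⟨u, hu⟩ := hrf j
          refine ⟨u, ?_⟩
          show f j / d j = r j / d j * u
          rw [hu]
          exact (Nat.div_mul_right_comm (hdr j) u).symm
        · intro h0
          have h1 := hfm j
          rw [h0, mul_zero] at h1
          exact absurd h1 (Nat.one_le_iff_ne_zero.1 (hf1 j))
      · intro t ht
        have ht' : ∀ j, t j ∣ m j := fun j => (Nat.mem_divisors.1 (Fintype.mem_piFinset.1 ht j)).1
        have hdtf : ∀ j, d j * t j ∣ f j := fun j => by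
          rw [hfm j]; exact mul_dvd_mul_left _ (ht' j)
        refine Finset.mem_filter.2 ⟨Finset.mem_filter.2 ⟨mem_gBox_of_dvd hfbox hdtf, fun j => ?_⟩, hdtf⟩
        exact Dvd.intro _ rfl
      · intro r hr
        obtain ⟨hr1, -⟩ := Finset.mem_filter.1 hr
        obtain ⟨-, hdr⟩ := Finset.mem_filter.1 hr1
        funext j
        exact Nat.mul_div_cancel' (hdr j)
      · intro t _
        funext j
        exact Nat.mul_div_cancel_left _ (hd1 j)
      · intro r hr
        obtain ⟨hr1, -⟩ := Finset.mem_filter.1 hr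
        obtain ⟨-, hdr⟩ := Finset.mem_filter.1 hr1
        have hprod : (∏ j, d j * (r j / d j)) = ∏ j, r j :=
          Finset.prod_congr rfl fun j _ => Nat.mul_div_cancel' (hdr j)
        simp only [hprod]
    rw [hre]
    -- μ(∏ d t) = μ(D) μ(∏ t)
    have hsplit : ∀ t ∈ Fintype.piFinset (fun j => (m j).divisors),
        ((μ (∏ j, d j * t j) : ℤ) : ℝ) = ((μ D : ℤ) : ℝ) * ((μ (∏ j, t j) : ℤ) : ℝ) := by
      intro t ht
      have ht' : ∀ j, t j ∣ m j := fun j => (Nat.mem_divisors.1 (Fintype.mem_piFinset.1 ht j)).1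
      have hprod : ∏ j, d j * t j = D * ∏ j, t j := by rw [hD, ← Finset.prod_mul_distrib]
      have hsq2 : Squarefree (D * ∏ j, t j) := by
        rw [← hprod]
        exact hfsq.squarefree_of_dvd (Finset.prod_dvd_prod_of_dvd _ _ fun j _ => by
          rw [hfm j]; exact mul_dvd_mul_left _ (ht' j))
      have hcop : Nat.Coprime D (∏ j, t j) := (Nat.squarefree_mul_iff.1 hsq2).1
      rw [hprod, ArithmeticFunction.isMultiplicative_moebius.map_mul_of_coprime hcop]
      push_cast
      ring
    rw [Finset.sum_congr rfl hsplit, ← Finset.mul_sum, sum_piFinset_divisors_moebius hmsq]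
    congr 1
    have hiff : (∀ j, m j = 1) ↔ f = d := by
      constructor
      · intro h; funext j; rw [hfm j, h j, mul_one]
      · intro h j
        rw [hm]
        show f j / d j = 1
        rw [h]; exact Nat.div_self (hd1 j)
    simp only [hiff]
  -- Step 3: assemble.
  unfold lamOfY
  rw [hswap, Finset.sum_congr rfl fun f hf => by rw [hinner f hf]]
  have hpick : ∑ f ∈ box.filter (fun f => ∀ j, d j ∣ f j),
      Λ f / (∏ j, (f j : ℝ)) * (((μ D : ℤ) : ℝ) * if f = d then 1 else 0) =
      Λ d / (∏ j, (d j : ℝ)) * ((μ D : ℤ) : ℝ) := by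
    rw [Finset.sum_eq_single_of_mem d (Finset.mem_filter.2 ⟨hd, fun j => dvd_refl _⟩)]
    · simp
    · intro f _ hfd
      rw [if_neg hfd]; ring
  rw [hpick]
  have hμ2 : ((μ D : ℤ) : ℝ) * ((μ D : ℤ) : ℝ) = 1 := by
    have h := ArithmeticFunction.moebius_sq_eq_one_of_squarefree hDsq
    have h' := congrArg (fun z : ℤ => (z : ℝ)) h
    push_cast at h'
    rw [← h']; ring
  have hDcast : (∏ j, (d j : ℝ)) = (D : ℝ) := by rw [hD]; push_cast; rfl
  rw [hDcast]
  simp only [← hD]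
  calc ((μ D : ℤ) : ℝ) * (D : ℝ) * (Λ d / (D : ℝ) * ((μ D : ℤ) : ℝ))
      = (((μ D : ℤ) : ℝ) * ((μ D : ℤ) : ℝ)) * Λ d * ((D : ℝ) / (D : ℝ)) := by ring
    _ = Λ d := by rw [hμ2, div_self hD0]; ring

/-! ### Arithmetic helpers -/

omit [Fintype ι] in
/-- The cross-coprimality predicate is unchanged when `d_j` is replaced by a value `v` with
`(v e_j, n) = 1 ↔ (d_j e_j, n) = 1` for the other `n = d_l e_l`.
[cite: Maynard2016DenseClusters, proof of Prop. 9.1 p. 19 (∑' restriction)] -/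
theorem cross_update_iff (d e : ι → ℕ) (j : ι) (v : ℕ)
    (hv : ∀ n : ℕ, (∃ l, l ≠ j ∧ n = d l * e l) → ((v * e j).Coprime n ↔ (d j * e j).Coprime n)) :
    (∀ i l, i ≠ l → (Function.update d j v i * e i).Coprime (Function.update d j v l * e l)) ↔
      ∀ i l, i ≠ l → (d i * e i).Coprime (d l * e l) := by
  refine forall_congr' fun i => forall_congr' fun l => imp_congr_right fun hil => ?_
  by_cases hi : i = j
  · subst hi
    have hl : l ≠ i := fun h => hil h.symm
    rw [Function.update_self, Function.update_of_ne hl]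
    exact hv _ ⟨l, hl, rfl⟩
  · by_cases hl : l = j
    · subst hl
      rw [Function.update_self, Function.update_of_ne hi, Nat.coprime_comm,
        hv _ ⟨i, hi, rfl⟩, Nat.coprime_comm]
    · rw [Function.update_of_ne hi, Function.update_of_ne hl]

/-! ### The sign-reversing involution: `S_p = 0` -/

/-- **The case `S_p = 0` of (9.5) on a general box**: for `r ∈ box`, `e ∣ s` coordinatewise, and a
prime `p ∣ r_j` with `p ∤ ∏ s_i`, the `d`-sum of `pairTerm d e` over the divisor vectors of `r`
vanishes (involution `d_j ↦ d_j p^{±1}`).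
[cite: Maynard2016DenseClusters, proof of Prop. 9.1 p. 19, (9.5) (case «p ∣ r and p ∤ s»); proof of Prop. 9.4 p. 25] -/
theorem sum_filter_dvd_pairTerm_eq_zero {N W : ι → ℕ} {r s e : ι → ℕ}
    (hr : r ∈ gBox N W) (he : ∀ i, e i ∣ s i) {p : ℕ} (hp : p.Prime) {j : ι} (hpj : p ∣ r j)
    (hps : ¬ p ∣ ∏ i, s i) :
    ∑ d ∈ (gBox N W).filter (fun d => ∀ i, d i ∣ r i), pairTerm d e = 0 := by
  have hpprime : Prime p := Nat.prime_iff.1 hp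
  have hpe : ∀ i, ¬ p ∣ e i := fun i h =>
    hps ((h.trans (he i)).trans (Finset.dvd_prod_of_mem _ (Finset.mem_univ i)))
  have hrsq : Squarefree (r j) := squarefree_apply_of_mem_gBox hr j
  have lcm_prime_mul_left : ∀ {a b : ℕ}, p.Coprime b → Nat.lcm (p * a) b = p * Nat.lcm a b :=
    fun {a b} hpb => by
      rw [Nat.lcm, Nat.lcm, Nat.Coprime.gcd_mul_left_cancel a hpb, mul_assoc,
        Nat.mul_div_assoc p ((Nat.gcd_dvd_left a b).mul_right b)]
  have moebius_prime_mul : ∀ {m : ℕ}, ¬ p ∣ m → μ (p * m) = -μ m := fun {m} hpm => by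
    rw [ArithmeticFunction.isMultiplicative_moebius.map_mul_of_coprime
        ((Nat.Prime.coprime_iff_not_dvd hp).2 hpm), ArithmeticFunction.moebius_apply_prime hp]
    ring
  set tog : (ι → ℕ) → (ι → ℕ) := fun d =>
    Function.update d j (if p ∣ d j then d j / p else d j * p) with htog
  have hdi : ∀ d : ι → ℕ, (∀ i, d i ∣ r i) → ∀ i, i ≠ j → ¬ p ∣ d i := by
    intro d hd i hij h
    have hg := Nat.dvd_gcd (h.trans (hd i)) hpj
    rw [(coprime_apply_of_mem_gBox hr hij).gcd_eq_one] at hg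
    exact hp.one_lt.ne' (Nat.dvd_one.1 hg)
  have hdsq : ∀ d : ι → ℕ, (∀ i, d i ∣ r i) → Squarefree (d j) := fun d hd =>
    hrsq.squarefree_of_dvd (hd j)
  have hdivndvd : ∀ d : ι → ℕ, (∀ i, d i ∣ r i) → p ∣ d j → ¬ p ∣ d j / p := by
    intro d hd hpd h
    rw [Nat.dvd_div_iff_mul_dvd hpd] at h
    exact hp.not_isUnit (hdsq d hd p h)
  have htog_dvd : ∀ d : ι → ℕ, (∀ i, d i ∣ r i) → ∀ i, tog d i ∣ r i := by
    intro d hd i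
    by_cases hi : i = j
    · subst hi
      simp only [htog, Function.update_self]
      split_ifs with hpd
      · exact (Nat.div_dvd_of_dvd hpd).trans (hd i)
      · exact Nat.Coprime.mul_dvd_of_dvd_of_dvd
          (Nat.coprime_comm.1 ((Nat.Prime.coprime_iff_not_dvd hp).2 hpd)) (hd i) hpj
    · simp only [htog, Function.update_of_ne hi]; exact hd i
  refine Finset.sum_involution (fun d _ => tog d) ?_ ?_ ?_ ?_
  · intro d hd
    obtain ⟨-, hdr⟩ := Finset.mem_filter.1 hd
    have hdi' := hdi d hdr
    have key : ((∀ i l, i ≠ l → (tog d i * e i).Coprime (tog d l * e l)) ↔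
          ∀ i l, i ≠ l → (d i * e i).Coprime (d l * e l)) ∧
        ((μ (∏ i, tog d i) : ℤ) : ℝ) = -((μ (∏ i, d i) : ℤ) : ℝ) ∧
        (∏ i, (tog d i : ℝ)) / ∏ i, ((Nat.lcm (tog d i) (e i) : ℕ) : ℝ) =
          (∏ i, (d i : ℝ)) / ∏ i, ((Nat.lcm (d i) (e i) : ℕ) : ℝ) := by
      have hP0 : ∏ i, d i = d j * ∏ i ∈ Finset.univ \ {j}, d i := by
        conv_lhs => rw [← Function.update_eq_self j d]
        exact Finset.prod_update_of_mem (Finset.mem_univ j) d (d j)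
      have hP1 : ∏ i, tog d i =
          (if p ∣ d j then d j / p else d j * p) * ∏ i ∈ Finset.univ \ {j}, d i := by
        simp only [htog]; exact Finset.prod_update_of_mem (Finset.mem_univ j) d _
      have hQ0 : ∏ i, Nat.lcm (d i) (e i) =
          Nat.lcm (d j) (e j) * ∏ i ∈ Finset.univ \ {j}, Nat.lcm (d i) (e i) := by
        conv_lhs => rw [← Function.update_eq_self j (fun i => Nat.lcm (d i) (e i))]
        exact Finset.prod_update_of_mem (Finset.mem_univ j) (fun i => Nat.lcm (d i) (e i)) _
      have hQ1 : ∏ i, Nat.lcm (tog d i) (e i) =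
          Nat.lcm (if p ∣ d j then d j / p else d j * p) (e j) *
            ∏ i ∈ Finset.univ \ {j}, Nat.lcm (d i) (e i) := by
        have : (fun i => Nat.lcm (tog d i) (e i)) =
            Function.update (fun i => Nat.lcm (d i) (e i)) j
              (Nat.lcm (if p ∣ d j then d j / p else d j * p) (e j)) := by
          funext i
          by_cases hi : i = j
          · subst hi; simp only [htog, Function.update_self]
          · simp only [htog, Function.update_of_ne hi]
        rw [this]; exact Finset.prod_update_of_mem (Finset.mem_univ j) _ _
      have hrest : ¬ p ∣ ∏ i ∈ Finset.univ \ {j}, d i := by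
        rw [hpprime.dvd_finsetProd_iff]
        rintro ⟨i, hi, hpi⟩
        exact hdi' i (by simpa using hi) hpi
      have hpej : p.Coprime (e j) := (Nat.Prime.coprime_iff_not_dvd hp).2 (hpe j)
      have hcross : (∀ i l, i ≠ l → (tog d i * e i).Coprime (tog d l * e l)) ↔
          ∀ i l, i ≠ l → (d i * e i).Coprime (d l * e l) := by
        simp only [htog]
        refine cross_update_iff d e j _ fun n hn => ?_
        obtain ⟨l, hl, rfl⟩ := hn
        have hpn : ¬ p ∣ d l * e l := by
          rw [hp.dvd_mul, not_or]; exact ⟨hdi' l hl, hpe l⟩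
        split_ifs with hpd
        · conv_rhs => rw [← Nat.div_mul_cancel hpd,
            show d j / p * p * e j = p * (d j / p * e j) by ring]
          rw [FGKMT2018.coprime_prime_mul_iff hp hpn]
        · rw [show d j * p * e j = p * (d j * e j) by ring, FGKMT2018.coprime_prime_mul_iff hp hpn]
      refine ⟨hcross, ?_, ?_⟩
      · rw [hP1, hP0]
        split_ifs with hpd
        · have h1 : d j * ∏ i ∈ Finset.univ \ {j}, d i =
              p * (d j / p * ∏ i ∈ Finset.univ \ {j}, d i) := by
            conv_lhs => rw [← Nat.div_mul_cancel hpd]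
            ring
          have hnd : ¬ p ∣ d j / p * ∏ i ∈ Finset.univ \ {j}, d i := by
            rw [hp.dvd_mul, not_or]; exact ⟨hdivndvd d hdr hpd, hrest⟩
          rw [h1, moebius_prime_mul hnd]; push_cast; ring
        · have h1 : d j * p * ∏ i ∈ Finset.univ \ {j}, d i =
              p * (d j * ∏ i ∈ Finset.univ \ {j}, d i) := by ring
          have hnd : ¬ p ∣ d j * ∏ i ∈ Finset.univ \ {j}, d i := by
            rw [hp.dvd_mul, not_or]; exact ⟨hpd, hrest⟩
          rw [h1, moebius_prime_mul hnd]; push_cast; ring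
      · have hN : (∏ i, tog d i) * ∏ i, Nat.lcm (d i) (e i) =
            (∏ i, d i) * ∏ i, Nat.lcm (tog d i) (e i) := by
          rw [hP1, hP0, hQ0, hQ1]
          split_ifs with hpd
          · set v := d j / p with hv
            have hdj : d j = p * v := by rw [hv, mul_comm, Nat.div_mul_cancel hpd]
            rw [hdj, lcm_prime_mul_left hpej]
            ring
          · rw [show d j * p = p * d j by ring, lcm_prime_mul_left hpej]
            ring
        have hΛ0 : (0 : ℝ) < ∏ i, ((Nat.lcm (d i) (e i) : ℕ) : ℝ) := by
          refine Finset.prod_pos fun i _ => ?_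
          have h1 := one_le_of_mem_gBox (mem_gBox_of_dvd hr hdr) i
          have h2 : e i ≠ 0 := fun h0 => hpe i (by rw [h0]; exact dvd_zero p)
          exact_mod_cast Nat.lcm_pos h1 (Nat.pos_of_ne_zero h2)
        have hΛ1 : (0 : ℝ) < ∏ i, ((Nat.lcm (tog d i) (e i) : ℕ) : ℝ) := by
          refine Finset.prod_pos fun i _ => ?_
          have h1 := one_le_of_mem_gBox (mem_gBox_of_dvd hr (htog_dvd d hdr)) i
          have h2 : e i ≠ 0 := fun h0 => hpe i (by rw [h0]; exact dvd_zero p)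
          exact_mod_cast Nat.lcm_pos h1 (Nat.pos_of_ne_zero h2)
        rw [div_eq_div_iff hΛ1.ne' hΛ0.ne']
        have := congrArg (fun n : ℕ => (n : ℝ)) hN
        push_cast at this
        exact this
    obtain ⟨hc, hμ, hfrac⟩ := key
    by_cases hcr : ∀ i l, i ≠ l → (d i * e i).Coprime (d l * e l)
    · simp only [pairTerm]
      rw [if_pos hcr, if_pos (hc.2 hcr)]
      rw [show ((μ (∏ i, tog d i) : ℤ) : ℝ) * ((μ (∏ i, e i) : ℤ) : ℝ) *
              ((∏ i, (tog d i : ℝ)) * ∏ i, (e i : ℝ)) / ∏ i, ((Nat.lcm (tog d i) (e i) : ℕ) : ℝ) =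
            ((μ (∏ i, tog d i) : ℤ) : ℝ) * ((μ (∏ i, e i) : ℤ) : ℝ) * (∏ i, (e i : ℝ)) *
              ((∏ i, (tog d i : ℝ)) / ∏ i, ((Nat.lcm (tog d i) (e i) : ℕ) : ℝ)) by ring,
        hfrac, hμ]
      ring
    · simp only [pairTerm]
      rw [if_neg hcr, if_neg (fun h => hcr (hc.1 h)), add_zero]
  · intro d hd _ h
    obtain ⟨-, hdr⟩ := Finset.mem_filter.1 hd
    have hj := congr_fun h j
    simp only [htog, Function.update_self] at hj
    have hd1 : 1 ≤ d j := one_le_of_mem_gBox (mem_gBox_of_dvd hr hdr) j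
    split_ifs at hj with hpd
    · exact (Nat.div_lt_self hd1 hp.one_lt).ne hj
    · have : d j * p = d j * 1 := by rw [hj, mul_one]
      exact hp.one_lt.ne' (Nat.eq_of_mul_eq_mul_left hd1 this)
  · intro d hd
    obtain ⟨-, hdr⟩ := Finset.mem_filter.1 hd
    exact Finset.mem_filter.2 ⟨mem_gBox_of_dvd hr (htog_dvd d hdr), htog_dvd d hdr⟩
  · intro d hd
    obtain ⟨-, hdr⟩ := Finset.mem_filter.1 hd
    funext i
    by_cases hi : i = j
    · subst hi
      simp only [htog, Function.update_self]
      split_ifs with hpd h2 h3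
      · exact absurd h2 (hdivndvd d hdr hpd)
      · exact Nat.div_mul_cancel hpd
      · exact Nat.mul_div_cancel _ hp.pos
      · exact absurd (Dvd.intro_left _ rfl) h3
    · simp only [htog, Function.update_of_ne hi]

/-! ### `T(r,s) = 0` unless `∏ r_j = ∏ s_j` -/

/-- `pairTerm d e = pairTerm e d`. [cite: Maynard2016DenseClusters, (9.2) p. 19] -/
theorem pairTerm_comm (d e : ι → ℕ) : pairTerm d e = pairTerm e d := by
  unfold pairTerm
  have hiff : (∀ i l, i ≠ l → (d i * e i).Coprime (d l * e l)) ↔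
      ∀ i l, i ≠ l → (e i * d i).Coprime (e l * d l) := by
    simp only [mul_comm]
  by_cases h : ∀ i l, i ≠ l → (d i * e i).Coprime (d l * e l)
  · rw [if_pos h, if_pos (hiff.1 h)]
    simp only [Nat.lcm_comm (d _) (e _)]
    ring
  · rw [if_neg h, if_neg (fun h' => h (hiff.2 h'))]

/-- `T(r,s) = T(s,r)`. [cite: Maynard2016DenseClusters, (9.2) p. 19] -/
theorem pairT_comm (N W : ι → ℕ) (r s : ι → ℕ) : pairT N W r s = pairT N W s r := by
  unfold pairT
  rw [Finset.sum_comm]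
  exact Finset.sum_congr rfl fun e _ => Finset.sum_congr rfl fun d _ => pairTerm_comm d e

/-- **`T(r,s) = 0` if a prime divides `∏ r_j` but not `∏ s_j`** (`r ∈ box`).
[cite: Maynard2016DenseClusters, proof of Prop. 9.1 p. 19 (after (9.5)); proof of Prop. 9.4 p. 25] -/
theorem pairT_eq_zero_of_dvd_of_not_dvd {N W : ι → ℕ} {r s : ι → ℕ} (hr : r ∈ gBox N W)
    {p : ℕ} (hp : p.Prime) (hpr : p ∣ ∏ i, r i) (hps : ¬ p ∣ ∏ i, s i) : pairT N W r s = 0 := by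
  obtain ⟨j, -, hpj⟩ := ((Nat.prime_iff.1 hp).dvd_finsetProd_iff _).1 hpr
  unfold pairT
  rw [Finset.sum_comm]
  refine Finset.sum_eq_zero fun e he => ?_
  exact sum_filter_dvd_pairTerm_eq_zero hr (Finset.mem_filter.1 he).2 hp hpj hps

/-- `T(r,s) = 0` if a prime divides `∏ s_j` but not `∏ r_j` (`s ∈ box`).
[cite: Maynard2016DenseClusters, proof of Prop. 9.1 p. 19 (after (9.5))] -/
theorem pairT_eq_zero_of_not_dvd_of_dvd {N W : ι → ℕ} {r s : ι → ℕ} (hs : s ∈ gBox N W)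
    {p : ℕ} (hp : p.Prime) (hpr : ¬ p ∣ ∏ i, r i) (hps : p ∣ ∏ i, s i) : pairT N W r s = 0 := by
  rw [pairT_comm]
  exact pairT_eq_zero_of_dvd_of_not_dvd hs hp hps hpr

/-- **«We can restrict to `r = s`»**: `T(r,s) = 0` unless `∏ r_j = ∏ s_j` (`r, s ∈ box`).
[cite: Maynard2016DenseClusters, proof of Prop. 9.1 p. 19 (after (9.5)); proof of Prop. 9.4 p. 25] -/
theorem pairT_eq_zero_of_prod_ne {N W : ι → ℕ} {r s : ι → ℕ} (hr : r ∈ gBox N W)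
    (hs : s ∈ gBox N W) (hne : (∏ i, r i) ≠ ∏ i, s i) : pairT N W r s = 0 := by
  have h := (Nat.Squarefree.ext_iff (squarefree_of_mem_gBox hr) (squarefree_of_mem_gBox hs)).not.1 hne
  obtain ⟨p, hp'⟩ := not_forall.1 h
  obtain ⟨hp, hiff⟩ := Classical.not_imp.1 hp'
  by_cases hpr : p ∣ ∏ i, r i
  · exact pairT_eq_zero_of_dvd_of_not_dvd hr hp hpr (fun hps => hiff ⟨fun _ => hps, fun _ => hpr⟩)
  · refine pairT_eq_zero_of_not_dvd_of_dvd hs hp hpr ?_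
    by_contra hps
    exact hiff ⟨fun h => absurd h hpr, fun h => absurd h hps⟩

end Literature.NumberTheory.Sieve.SelbergBox
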